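import Literature.MathematicalPhysics.QuantumFieldTheory.Balaban1983to89.B9B8KnitLetterCinvTransfer
import Literature.MathematicalPhysics.QuantumFieldTheory.Balaban1983to89.B9Thm32CinvAtMemberOfCubeData
import Literature.MathematicalPhysics.QuantumFieldTheory.Balaban1983to89.B9SectDSup

/-!
# `Balaban1983to89.B9Thm32CinvAtKnitLetterOfCubeData` — [B9] THEOREM 3.2 (3.48) FOR `C(U) = (Q′G′²Q′*)⁻¹(U)` AT PRINT's KNIT LETTER `parKnitY`, AT A
# `U(N)`-VALUED (3.35)-REGULAR BACKGROUND OF [B7]'s CLASS (52), FOR EVERY MEMBER ABOVE ONE THRESHOLD, FROM THE PER-CUBE (3.35) DATA, MODULO THEOREM D —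
# the knit twin of FILE 10 (`B9Thm32CinvAtMemberOfCubeData`): FILE 9 (Theorem 3.1's block of `G′` at def-Y's letter) + junction file 9 (`G′` at the knit letter)
# + FILE 10 ((3.48) at def-Y's letter) + junction files 23a–23c (the `C`-transfer), with the located smallness DISCHARGED by one admissible size `a₀` of the
# class parameter `α₀′` and the geometry discharged above one threshold (module G′′′ of sub-row G-B9-LETTERS; seat p33; consumer: the knit assembler's `hC`)

statement-level skeleton of published theorems with citation tags; proofs where landed; nothing here is a claim about the
Yang–Mills mass gap

T. Bałaban, *Propagators for lattice gauge theories in a background field*, Commun. Math. Phys. **99** (1985) 389–434 [`Balaban1985BackgroundPropagators`,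
"[B9]"]; T. Bałaban, *Propagators and renormalization transformations for lattice gauge theories. II*, Commun. Math. Phys. **96** (1984) 223–250
[`Balaban1984PropagatorsII`, "[4]"]; T. Bałaban, *Averaging operations for lattice gauge theories*, Commun. Math. Phys. **98** (1985) 17–51
[`Balaban1985Averaging`, "[B7]"].

THE PRINT.  [B9] Thm 3.2 (3.48) p. 398 («|(Q′G′²Q′*)⁻¹(U; y, y′)| ≦ O(1)(Lʲη)⁻⁴exp(−δd(y,y′))» for `U` regular on big cubes «e.g., by (52), (53) in [5]», p. 393
(3.19)), Thm 3.1 (3.42) p. 397, Cor. 3.6 p. 408, Thm 3.7 pp. 409–410, Thm 3.9 p. 413 («For M sufficiently large»), (3.95)–(3.97) pp. 411–412, Thm 3.11 p. 416;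
[4] Prop. 2.2 (2.50)–(2.52) p. 232, Lemma 2.1 (2.60)–(2.67) p. 234 («with a decay rate arbitrarily close»), (2.83)–(2.85) p. 237; [B7] (52)–(53) pp. 26–27 («α₀
sufficiently small»).

WHY THIS FILE ∕ THE ARGUMENT.  The knit consumer (`B8Thm2TorusLetters.LettersAt`, junction files 17–22; RECORD-JB-g95 §«How the assembler uses this») displays
`hC : conj b(s•(Q′G′²Q′*)⁻¹(U; parKnitY)) ≺ K·(ℓ(a)⁴)⁻¹·e^{−δd}` on def-Y's block carrier.  FILE 10 proves this shape at def-Y's letter of record `parSymY` from the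
per-cube (3.35) data (modulo Theorem D); junction file 23c transfers it to `parKnitY` given four letters in [4]'s (2.51) currency — `η²G′` at both letters, the
diagonal of `η⁻²(Δ′_sym − Δ′_knit)`, `η⁻⁴X_sym⁻¹` — and a located smallness `θ_R·c₁ < 1` with `θ_R = α₀′·Φ_R`.  THIS FILE feeds file 23c §4 from the cube data:
`η²G′_sym` ← FILE 9's (3.42) block read by D1's `hasMajorant_conj_G_of_eBlockInv` (`A_s = M₂Σ‖b‖·K_G`); `η²G′_knit` ← junction file 9 in print's units
(`hasMajorant_conj_GpY_parKnitY_print`: `P = ℓ² ≤ 1`, `θ = α₀′·32(d+1)²M₂Σ‖b‖A_s`, constant weakened to `2A_sc₁` under `θc₁ ≤ ½`); the diagonal ← file 9 §1 in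
print's units (`θ_E = 32(d+1)²α₀′M₂Σ‖b‖`, `inv_etaS_sq_mul`); `η⁻⁴X_sym⁻¹` ← FILE 10; the geometry ((2.54), (2.61)∕(2.63) at the seven rates of the ladder, the scale
transfers of `ℓ²` and `ℓ⁻⁴`) ← `geo_inputs3_geo9K` and `scaleTransfer_len_sq∕inv4_geo9K` above ONE threshold (`geo_ladder`); and BOTH located smallnesses are
discharged by the admissible size `α₀′ ≤ a₀ := min(1∕(2(Φ₁+1)), 1∕(2(Φ_R+1)))` (`small_of_le`: `α₀′Φ ≤ ½`, so `(1 − θc₁)⁻¹ ≤ 2`).  All rates are halvings of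
`r = min(δ_G, δ_T)` (`α = α′ = α_st = ½` — an AS-PRINTED deviation: «arbitrarily close» is not pursued); the output constant `2K_Tc₁` and rate `r∕2⁸` do not
depend on `U`, on the member, or on `α₀′`.

CITATION HEADER (lean-in-tree rule).  Cell `lit-balaban`, sub-row G-B9-LETTERS, module M5.1b-G‴ FILE 11 → seat `lit-balaban-p33` gen 98.  REUSED BY NAME: p33 FILE 9
`B9Cor36GpCoverBindersUnitary.eBlock_GpY_of_cubeData_unitary`, FILE 10 `B9Thm32CinvAtMemberOfCubeData.cinv_at_member_of_cubeData_unitary`, J-B 9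
`B9B8KnitLetterMajorantTransfer.{hasMajorant_conj_GpY_parKnitY_of_parSymY, hasMajorant_conj_smul_sub, inv_etaS_sq_mul, geo9K_len_sq_le_one}`, J-B 23b∕c
`B9B8KnitLetterXDiffMajorant.hasMajorant_rate_mono`, `B9B8KnitLetterCinvTransfer.hasMajorant_conj_XinvY_parKnitY_of_letters`, D1 `B9CubeLettersInvReadDict.hasMajorant_conj_G_of_eBlockInv`,
p21 FILE 11 `B9GeoInputsMultiRateKLevelV1.{geo_inputs3_geo9K, scaleTransfer_len_sq_geo9K, scaleTransfer_len_inv4_geo9K}`, `B9Thm37GpAtCoverLarge.geo9K_M_eq'`, `B9SectDSup.inv_one_sub_le_two`.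

WHAT THIS FILE PROVES (sorry-free; no definitions).
* §1 `small_of_le`, `st_size` (the scale-transfer size condition above a threshold; `(1 − x)⁻¹ ≤ 2` is `B9SectDSup.inv_one_sub_le_two`), ★ `geo_ladder` (the member's geometry at the rate ladder
  `r, r∕2, …, r∕2⁷` and the three scale transfers, above ONE threshold `ML ≤ M`).
* §2 ★ `hasMajorant_conj_smul_sub_print` (file 9 §1 in print's units: `θ_E = 32(d+1)²α₀′M₂Σ‖b‖`), ★★ `hasMajorant_conj_GpY_parKnitY_print` (file 9's ★★★ at `P = ℓ²`,
  `η = etaS`, `α = ½`, smallness `α₀′·32(d+1)²M₂Σ‖b‖Ac₁ ≤ ½`, constant `2Ac₁`).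
* §3 ★★★ **`cinv_at_knit_member_of_cubeData_unitary`** — for `G ≤ U(N)` averaging-closed, `N ≥ 1`, `(Rr, Hp)`, a real basis `b` with coordinate bound `M₂`, `ℓ ≥ 1`,
  Theorem D's `κ_D ≥ 0`, `δ_D > 0`: there are `δ > 0`, `K ≥ 0`, thresholds `M₀, T₀, N₀`, `a₁ > 0` AND `a₀ > 0` such that for every `0 < α₀′ ≤ a₀` with `C₀α₀′ ≤ ⅓`,
  `2α₀′ ≤ c₂′`, every member above the thresholds with `c_f = L^k`, every section `ιB`, every `G`-valued `U` with `pdev (liftCfg U) < α₀′(L^k)⁻²`, every family of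
  per-cube (3.35) data (FILE 10's eleven hypotheses verbatim) and every background family through `U`: IF Theorem D's rate-function majorants hold (FILE 10's `hDf`
  verbatim), THEN `conj b((η²η²)⁻¹•(Q′G′²Q′*)⁻¹(U; parKnitY)) ≺ K·(ℓ(a)⁴)⁻¹·e^{−δ·d(a,a′)}` on `(s, j) ↦ ιB s` — the knit consumer's `hC`, token-identical.

HONEST SCOPE.  Composition of landed results above thresholds; modulo Theorem D exactly as FILE 10 (the displayed `hDf`, cell GAPS G-B9-05); the class-(52) size `a₀`
is explicit in the proof (not optimised) and realises [B7]'s «α₀ sufficiently small»; rates halved at each of the eight composition steps (AS-PRINTED deviation from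
«arbitrarily close», labelled); `d ≥ 0` arbitrary, `𝔸 = M_N(ℂ)`, `N ≥ 1`.  Count-neutral: (3.48) at the knit letter is one INPUT of [B8]'s (E15)∕(E6)–(E8) readings,
nothing of [B8] Thm 2 is asserted; nothing continuum, nothing about OS axioms or the mass gap.  No `sorry`, no `axiom`, no `… : Prop` fact, no `instance`, no
`notation`, no `def`.  NEW file; nothing landed is modified (v1.1: docstring of the ★★★ theorem gains the DESIGN-constants ∕ `a₀`-dependence list; statements and proofs unchanged).  Net new unproved facts: 0.
Seat `lit-balaban-p33` gen 98, 2026-08-28.  RELATED, NOT DUPLICATED (searched 2026-08-28: `lean search 'cinv_at_knit|AtKnitLetterOfCubeData|geo_ladder' --decl` = ∅): FILE 10 (def-Y's letter; used by name), J-B 20∕22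
`B9B8KnitLetterCinvFromM56` (hC at parKnitY from cube letters SUPPLIED AT parKnitY — a different input list; RECORD-JB-g95 CAVEAT), J-B 15 (the `G′`-line twin from M5.5 data).
-/

noncomputable section

open scoped BigOperators Matrix Matrix.Norms.L2Operator

namespace Literature.MathematicalPhysics.QuantumFieldTheory.Balaban1983to89.B9Thm32CinvAtKnitLetterOfCubeData

open B4PartitionUnity22 (thetaProf D1)
open B9Eq39Adjoint (fluct covD)
open B6Geom246MultiLevelBox (blkOf)
open B6KLevelCensusIndexV1 (KIdx kGeo)
open B6Cover236MultiLevelBlocks (cubes)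
open B6Cover236MultiLevelTorusBlocks (hB cubeIndT)
open B6GlobalChartV1 (PV boxEquiv)
open B6Ineq2142KLevelV1 (β)
open B6RandomWalk (HasMajorant Triangle254 Ineq261 Ineq263 hasMajorant_mono c1_nonneg)
open B9BackgroundsKLevelV1 (shiftsV1)
open B9Eq352DivFormLetters (conj)
open B9Eq360DeltaPrimeAY (AfldY)
open B9CubeGeometryInputs (RM1)
open B9GeoNormsKLevelV1 (geo9K)
open B9GeoLemma21KLevelV1 (one_le_Mh geo9K_len_pos)
open B9GeoInputsMultiRateKLevelV1 (geo_inputs3_geo9K scaleTransfer_len_sq_geo9K scaleTransfer_len_inv4_geo9K)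
open B9RWSums347DefiniteFaces (exp261)
open B9SectDSup (inv_one_sub_le_two)
open B9Ineq347 (ScaleTransfer)
open B9Thm34Ext (toB6)
open B9FromB6 (EBlock)
open B9CubeLettersInvReadings (kernelFamilySInv)
open B9CubeLettersInvReadDict (hasMajorant_conj_G_of_eBlockInv)
open B9Cor36CubeCutoffs (SC NearC chiY locCfgY)
open B9Cor36GpCubeLocLetter (locLetterY)
open B9Cor36GpCoverBindersUnitary (eBlock_GpY_of_cubeData_unitary)
open B9Thm32CinvAtMemberOfCubeData (cinv_at_member_of_cubeData_unitary)
open B9Thm37CubeCoverCommutators (cutMulY)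
open B9Thm37CubeCoverCommutatorSizes (four_le_P')
open B9Thm37GpAtCoverLarge (geo9K_M_eq')
open B9Thm39CinvAtCover (chiBigT DsepT)
open B9B8KnitLetterMajorantTransfer (hasMajorant_conj_GpY_parKnitY_of_parSymY hasMajorant_conj_smul_sub inv_etaS_sq_mul geo9K_len_sq_le_one)
open B9B8KnitLetterXDiffMajorant (hasMajorant_rate_mono)
open B9B8KnitLetterCinvTransfer (hasMajorant_conj_XinvY_parKnitY_of_letters)
open B7Prop2Explicit (AvgClosed pdev C0 c2' unitaryUnits)
open B9B8CarrierDictionary (liftCfg)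
open B9B8AveragingJunction (parKnitY)
open Node00 (SiteY BlkY CfgY GaugeY IBondY toKT gaugeY parSymY XY XinvY GpY etaS deltaPrimeAY)

variable {d ℓ : ℕ} {hd : 1 ≤ d + 1} {hL : Odd (ℓ + 1) ∧ 1 < ℓ + 1} {b₀ b₁ : ℝ}

/-! ## §1 Elementary sizes, and the member's geometry at the rate ladder -/

/-- the located smallness, discharged by a size: `0 ≤ Φ`, `α ≤ 1∕(2(Φ+1))` ⟹ `αΦ ≤ ½`. [cite: Balaban1985Averaging, p.27 («α₀ sufficiently small»), bookkeeping] -/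
theorem small_of_le {Φ α : ℝ} (hΦ : 0 ≤ Φ) (h : α ≤ 1 / (2 * (Φ + 1))) : α * Φ ≤ 1 / 2 := by
  have h1 : α * Φ ≤ 1 / (2 * (Φ + 1)) * Φ := mul_le_mul_of_nonneg_right h hΦ
  have h2 : 1 / (2 * (Φ + 1)) * Φ ≤ 1 / 2 := by
    rw [div_mul_eq_mul_div, one_mul, div_le_iff₀ (by positivity)]
    nlinarith
  exact h1.trans h2

/-- the size condition of the scale transfers (`k·log L ≤ a(2L²−1)M`, `k ≤ 4`) above the threshold `4·log L∕(a₀(2L²−1)) ≤ M` for every product `a ≥ a₀ > 0`.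
[cite: Balaban1985BackgroundPropagators, p.398 (remark after (3.47)), Thm 3.9 p.413 («M sufficiently large»), bookkeeping] -/
theorem st_size {a a₀ M k : ℝ} (ha₀ : 0 < a₀) (ha : a₀ ≤ a) (hk : k ≤ 4)
    (hM : 4 * Real.log ((ℓ : ℝ) + 1) / (a₀ * (2 * ((ℓ : ℝ) + 1) ^ 2 - 1)) ≤ M) : k * Real.log ((ℓ : ℝ) + 1) ≤ a * (2 * ((ℓ : ℝ) + 1) ^ 2 - 1) * M := by
  have hP : 1 ≤ (2 * ((ℓ : ℝ) + 1) ^ 2 - 1) := by nlinarith [sq_nonneg ((ℓ : ℝ) + 1), (Nat.cast_nonneg ℓ : (0 : ℝ) ≤ ℓ)]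
  have hP0 : 0 < (2 * ((ℓ : ℝ) + 1) ^ 2 - 1) := by linarith
  have hlog : 0 ≤ Real.log ((ℓ : ℝ) + 1) := Real.log_nonneg (by linarith [(Nat.cast_nonneg ℓ : (0 : ℝ) ≤ ℓ)])
  have h4 : 4 * Real.log ((ℓ : ℝ) + 1) ≤ M * (a₀ * (2 * ((ℓ : ℝ) + 1) ^ 2 - 1)) := (div_le_iff₀ (by positivity)).1 hM
  have hM0 : 0 ≤ M := le_trans (div_nonneg (by positivity) (by positivity)) hM
  calc k * Real.log ((ℓ : ℝ) + 1) ≤ 4 * Real.log ((ℓ : ℝ) + 1) := mul_le_mul_of_nonneg_right hk hlog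
    _ ≤ M * (a₀ * (2 * ((ℓ : ℝ) + 1) ^ 2 - 1)) := h4
    _ ≤ M * (a * (2 * ((ℓ : ℝ) + 1) ^ 2 - 1)) := mul_le_mul_of_nonneg_left (mul_le_mul_of_nonneg_right ha hP0.le) hM0
    _ = a * (2 * ((ℓ : ℝ) + 1) ^ 2 - 1) * M := by ring

/-- ★ **THE MEMBER's GEOMETRY AT THE RATE LADDER `r, r∕2, …, r∕2⁷` ABOVE ONE THRESHOLD**: (2.54), `d(y,y) = 0`, `d ≥ 0`; [4] (2.61) at `(r∕4, ½)`, `(r∕16, ½)`, `(r, ½)`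
(with (2.63)), `(r∕64, ½)`, `(r∕128, ½)` (with (2.63)); the scale transfers of `ℓ²` at `r∕2` and `r∕8` (constant `L²`) and of `ℓ⁻⁴` at `r∕32` (constant `L⁴`), exponent
`½` — p21's `geo_inputs3_geo9K` twice and `scaleTransfer_len_sq∕inv4_geo9K` under `st_size`.
[cite: Balaban1984PropagatorsII, Lemma 2.1 (2.60)–(2.63) p.234; Balaban1985BackgroundPropagators, p.398, Thm 3.9 p.413] -/
theorem geo_ladder [∀ i' : KIdx d ℓ hd hL b₀ b₁, Fintype (geo9K i').Site] (Rr : KIdx d ℓ hd hL b₀ b₁ → ℝ) (Hp : KIdx d ℓ hd hL b₀ b₁ → Prop)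
    {r : ℝ} (hr : 0 < r) :
    ∃ ML : ℝ, ∃ d₁ d₂ d₃ d₄ d₅ : ℕ, ∀ i : KIdx d ℓ hd hL b₀ b₁, ML ≤ (geo9K i).M →
      (Triangle254 (toB6 (geo9K i) (Rr i) (Hp i)) ∧ (∀ y : (geo9K i).Site, (geo9K i).dist y y = 0) ∧
        (∀ a a' : (geo9K i).Site, 0 ≤ (geo9K i).dist a a')) ∧
      Ineq261 d₁ (toB6 (geo9K i) (Rr i) (Hp i)) ((1 - 1 / 2) * ((1 - 1 / 2) * r)) (1 / 2) ∧
      Ineq261 d₂ (toB6 (geo9K i) (Rr i) (Hp i)) ((1 - 1 / 2) * ((1 - 1 / 2) * ((1 - 1 / 2) * ((1 - 1 / 2) * r)))) (1 / 2) ∧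
      (Ineq261 d₅ (toB6 (geo9K i) (Rr i) (Hp i)) r (1 / 2) ∧ Ineq263 d₅ (toB6 (geo9K i) (Rr i) (Hp i)) r (1 / 2)) ∧
      Ineq261 d₃ (toB6 (geo9K i) (Rr i) (Hp i)) ((1 - 1 / 2) * ((1 - 1 / 2) * ((1 - 1 / 2) * ((1 - 1 / 2) * ((1 - 1 / 2) * ((1 - 1 / 2) * r)))))) (1 / 2) ∧
      Ineq261 d₄ (toB6 (geo9K i) (Rr i) (Hp i)) ((1 - 1 / 2) * ((1 - 1 / 2) * ((1 - 1 / 2) * ((1 - 1 / 2) * ((1 - 1 / 2) * ((1 - 1 / 2) * ((1 - 1 / 2) * r))))))) (1 / 2) ∧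
      Ineq263 d₄ (toB6 (geo9K i) (Rr i) (Hp i)) ((1 - 1 / 2) * ((1 - 1 / 2) * ((1 - 1 / 2) * ((1 - 1 / 2) * ((1 - 1 / 2) * ((1 - 1 / 2) * ((1 - 1 / 2) * r))))))) (1 / 2) ∧
      ScaleTransfer (geo9K i) ((1 - 1 / 2) * r) (1 / 2) (((ℓ : ℝ) + 1) ^ 2) (fun a => (geo9K i).len a ^ 2) ∧
      ScaleTransfer (geo9K i) ((1 - 1 / 2) * ((1 - 1 / 2) * ((1 - 1 / 2) * r))) (1 / 2) (((ℓ : ℝ) + 1) ^ 2) (fun a => (geo9K i).len a ^ 2) ∧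
      ScaleTransfer (geo9K i) ((1 - 1 / 2) * ((1 - 1 / 2) * ((1 - 1 / 2) * ((1 - 1 / 2) * ((1 - 1 / 2) * r))))) (1 / 2) (((ℓ : ℝ) + 1) ^ 4) (fun a => ((geo9K i).len a ^ 4)⁻¹) := by
  obtain ⟨MLA, hA⟩ := geo_inputs3_geo9K Rr Hp (δ₁ := (1 - 1 / 2) * ((1 - 1 / 2) * r)) (α₁ := 1 / 2) (δ₂ := (1 - 1 / 2) * ((1 - 1 / 2) * ((1 - 1 / 2) * ((1 - 1 / 2) * r)))) (α₂ := 1 / 2) (δ₃ := r) (α₃ := 1 / 2)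
    (by linarith) (by linarith) (by linarith) hr.le (by norm_num)
  obtain ⟨MLB, hB⟩ := geo_inputs3_geo9K Rr Hp (δ₁ := (1 - 1 / 2) * ((1 - 1 / 2) * ((1 - 1 / 2) * ((1 - 1 / 2) * ((1 - 1 / 2) * ((1 - 1 / 2) * r)))))) (α₁ := 1 / 2) (δ₂ := (1 - 1 / 2) * ((1 - 1 / 2) * ((1 - 1 / 2) * ((1 - 1 / 2) * ((1 - 1 / 2) * ((1 - 1 / 2) * r)))))) (α₂ := 1 / 2) (δ₃ := (1 - 1 / 2) * ((1 - 1 / 2) * ((1 - 1 / 2) * ((1 - 1 / 2) * ((1 - 1 / 2) * ((1 - 1 / 2) * ((1 - 1 / 2) * r))))))) (α₃ := 1 / 2)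
    (by linarith) (by linarith) (by linarith) (by linarith) (by norm_num)
  -- the scale transfers: the smallest product `a₀ = ½·r∕32`
  have ha₀ : 0 < 1 / 2 * ((1 - 1 / 2) * ((1 - 1 / 2) * ((1 - 1 / 2) * ((1 - 1 / 2) * ((1 - 1 / 2) * r))))) := by linarith
  refine ⟨max (max MLA MLB) (4 * Real.log ((ℓ : ℝ) + 1) / (1 / 2 * ((1 - 1 / 2) * ((1 - 1 / 2) * ((1 - 1 / 2) * ((1 - 1 / 2) * ((1 - 1 / 2) * r))))) * (2 * ((ℓ : ℝ) + 1) ^ 2 - 1))),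
    exp261 (geo9K (d := d) (ℓ := ℓ) (hd := hd) (hL := hL) (b₀ := b₀) (b₁ := b₁)) ((1 - 1 / 2) * ((1 - 1 / 2) * r)) (1 / 2),
    max (exp261 (geo9K (d := d) (ℓ := ℓ) (hd := hd) (hL := hL) (b₀ := b₀) (b₁ := b₁)) ((1 - 1 / 2) * ((1 - 1 / 2) * ((1 - 1 / 2) * ((1 - 1 / 2) * r)))) (1 / 2)) (exp261 (geo9K (d := d) (ℓ := ℓ) (hd := hd) (hL := hL) (b₀ := b₀) (b₁ := b₁)) r (1 / 2)),
    exp261 (geo9K (d := d) (ℓ := ℓ) (hd := hd) (hL := hL) (b₀ := b₀) (b₁ := b₁)) ((1 - 1 / 2) * ((1 - 1 / 2) * ((1 - 1 / 2) * ((1 - 1 / 2) * ((1 - 1 / 2) * ((1 - 1 / 2) * r)))))) (1 / 2),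
    max (exp261 (geo9K (d := d) (ℓ := ℓ) (hd := hd) (hL := hL) (b₀ := b₀) (b₁ := b₁)) ((1 - 1 / 2) * ((1 - 1 / 2) * ((1 - 1 / 2) * ((1 - 1 / 2) * ((1 - 1 / 2) * ((1 - 1 / 2) * r)))))) (1 / 2)) (exp261 (geo9K (d := d) (ℓ := ℓ) (hd := hd) (hL := hL) (b₀ := b₀) (b₁ := b₁)) ((1 - 1 / 2) * ((1 - 1 / 2) * ((1 - 1 / 2) * ((1 - 1 / 2) * ((1 - 1 / 2) * ((1 - 1 / 2) * ((1 - 1 / 2) * r))))))) (1 / 2)),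
    max (exp261 (geo9K (d := d) (ℓ := ℓ) (hd := hd) (hL := hL) (b₀ := b₀) (b₁ := b₁)) ((1 - 1 / 2) * ((1 - 1 / 2) * ((1 - 1 / 2) * ((1 - 1 / 2) * r)))) (1 / 2)) (exp261 (geo9K (d := d) (ℓ := ℓ) (hd := hd) (hL := hL) (b₀ := b₀) (b₁ := b₁)) r (1 / 2)), fun i hM => ?_⟩
  have hMA : MLA ≤ (geo9K i).M := ((le_max_left _ _).trans (le_max_left _ _)).trans hM
  have hMB : MLB ≤ (geo9K i).M := ((le_max_right _ _).trans (le_max_left _ _)).trans hM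
  have hMT : 4 * Real.log ((ℓ : ℝ) + 1) / (1 / 2 * ((1 - 1 / 2) * ((1 - 1 / 2) * ((1 - 1 / 2) * ((1 - 1 / 2) * ((1 - 1 / 2) * r))))) * (2 * ((ℓ : ℝ) + 1) ^ 2 - 1)) ≤ (geo9K i).M := (le_max_right _ _).trans hM
  obtain ⟨htri, hrefl, -, hdnn, h1, h2, h3, h3'⟩ := hA i hMA
  obtain ⟨-, -, -, -, h4, -, h5, h5'⟩ := hB i hMB
  refine ⟨⟨htri, hrefl, hdnn⟩, h1, h2, ⟨h3, h3'⟩, h4, h5, h5', ?_, ?_, ?_⟩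
  · exact scaleTransfer_len_sq_geo9K i (by linarith) (st_size ha₀ (by linarith) (by norm_num) hMT)
  · exact scaleTransfer_len_sq_geo9K i (by linarith) (st_size ha₀ (by linarith) (by norm_num) hMT)
  · exact scaleTransfer_len_inv4_geo9K i (by linarith) (st_size ha₀ le_rfl le_rfl hMT)

/-! ## §2 Junction file 9 in print's units -/

section Print

variable {N : ℕ} {G : Subgroup (Matrix (Fin N) (Fin N) ℂ)ˣ}
variable {ι : Type} [Fintype ι] [DecidableEq ι] (b : Module.Basis ι ℝ (Matrix (Fin N) (Fin N) ℂ))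
variable (i : KIdx d ℓ hd hL b₀ b₁) [Fintype (geo9K i).Site] [DecidableEq (geo9K i).Site] {Rr : ℝ} {Hp : Prop} (ιB : BlkY i → IBondY i)

omit [DecidableEq ι] [Fintype (geo9K i).Site] [DecidableEq (geo9K i).Site] in
/-- in lattice units `η = (L^k)⁻¹`: `(η²)⁻¹·32(d+1)²α₀′(L^k)⁻² = 32(d+1)²α₀′`. [cite: Balaban1984PropagatorsII, (2.1) p.224, bookkeeping] -/
theorem eps_print_units (α₀' : ℝ) :
    (etaS i ^ 2)⁻¹ * (32 * ((d : ℝ) + 1) ^ 2 * α₀' * (((((ℓ + 1) ^ i.k : ℕ) : ℝ)) ^ 2)⁻¹) = 32 * ((d : ℝ) + 1) ^ 2 * α₀' := by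
  calc (etaS i ^ 2)⁻¹ * (32 * ((d : ℝ) + 1) ^ 2 * α₀' * (((((ℓ + 1) ^ i.k : ℕ) : ℝ)) ^ 2)⁻¹)
      = 32 * ((d : ℝ) + 1) ^ 2 * α₀' * ((etaS i ^ 2)⁻¹ * (((((ℓ + 1) ^ i.k : ℕ) : ℝ)) ^ 2)⁻¹) := by ring
    _ = 32 * ((d : ℝ) + 1) ^ 2 * α₀' := by rw [inv_etaS_sq_mul, mul_one]

omit [DecidableEq ι] in
/-- ★ file 9 §1 in print's units: the block-diagonal majorant `32(d+1)²α₀′M₂Σ_j‖b_j‖·𝟙[a = a′]` of `conj b(η⁻²(Δ′_sym − Δ′_knit))`, `η = etaS`.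
[cite: Balaban1985BackgroundPropagators, (3.19) p.393; Balaban1985Averaging, (52)–(53) pp.26–27, (44) p.24; Balaban1984PropagatorsII, (2.1) p.224, (2.51) p.232] -/
theorem hasMajorant_conj_smul_sub_print [Nonempty (Fin N)] (hG : G ≤ unitaryUnits (Matrix (Fin N) (Fin N) ℂ)) (hGa : AvgClosed (d + 1) (ℓ + 1) G)
    {U : CfgY (Matrix (Fin N) (Fin N) ℂ) i} (hU : ∀ μ x, U μ x ∈ G) {α₀' : ℝ} (hα : 0 < α₀') (hα3 : C0 (d + 1) * α₀' ≤ 1 / 3)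
    (hα2 : 2 * α₀' ≤ c2' (d + 1) (ℓ + 1)) (h52 : pdev (liftCfg U) < α₀' * ((((ℓ + 1 : ℕ) : ℝ) ^ i.k)⁻¹) ^ 2)
    {M₂ : ℝ} (hM₂ : 0 ≤ M₂) (hrepr : ∀ (v : Matrix (Fin N) (Fin N) ℂ) (j : ι), |b.repr v j| ≤ M₂ * ‖v‖) :
    HasMajorant (g := toB6 (geo9K i) Rr Hp) (fun p : SiteY i × ι => ιB (blkOf i.D.toDomains p.1))
      (conj b ((etaS i ^ 2)⁻¹ • (deltaPrimeAY i (parSymY i) U - deltaPrimeAY i (parKnitY i) U).restrictScalars ℝ))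
      (fun a a' : (geo9K i).Site => if a = a' then 32 * ((d : ℝ) + 1) ^ 2 * α₀' * (M₂ * ∑ j, ‖b j‖) else 0) := by
  refine hasMajorant_mono _ (hasMajorant_conj_smul_sub i b ιB (Rr := Rr) (Hp := Hp) hG hGa hU hα hα3 hα2 h52 hM₂ hrepr ((etaS i ^ 2)⁻¹)) fun a a' => ?_
  have heq : |(etaS i ^ 2)⁻¹| * (32 * ((d : ℝ) + 1) ^ 2 * α₀' * (((((ℓ + 1) ^ i.k : ℕ) : ℝ)) ^ 2)⁻¹) = 32 * ((d : ℝ) + 1) ^ 2 * α₀' := by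
    rw [abs_of_nonneg (inv_nonneg.2 (sq_nonneg _)), eps_print_units]
  split_ifs
  · rw [heq]
  · exact le_rfl

/-- ★★ **(3.42)₁ AT THE KNIT LETTER FROM (3.42)₁ AT def-Y's LETTER, IN PRINT's UNITS** (junction file 9's ★★★ at `η = etaS`, `P = ℓ²` (`≤ 1` for `c_f = L^k`), `α = ½`):
the smallness in the located form `α₀′·(32(d+1)²M₂Σ‖b‖Ac₁(r,½)) ≤ ½` and the constant weakened to `2Ac₁(r,½)`, rate `r∕2`.
[cite: Balaban1985BackgroundPropagators, Thm 3.1 (3.42) p.397, (3.19) p.393, (3.90) pp.409–410; Balaban1984PropagatorsII, (2.50)–(2.51) p.232, (2.66)–(2.67) p.234; Balaban1985Averaging, (52)–(53) pp.26–27] -/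
theorem hasMajorant_conj_GpY_parKnitY_print [Nonempty (Fin N)] (hG : G ≤ unitaryUnits (Matrix (Fin N) (Fin N) ℂ)) (hGa : AvgClosed (d + 1) (ℓ + 1) G)
    {U : CfgY (Matrix (Fin N) (Fin N) ℂ) i} (hU : ∀ μ x, U μ x ∈ G) {α₀' : ℝ} (hα : 0 < α₀') (hα3 : C0 (d + 1) * α₀' ≤ 1 / 3)
    (hα2 : 2 * α₀' ≤ c2' (d + 1) (ℓ + 1)) (h52 : pdev (liftCfg U) < α₀' * ((((ℓ + 1 : ℕ) : ℝ) ^ i.k)⁻¹) ^ 2)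
    (hcf : i.cf = (((ℓ + 1 : ℕ) : ℝ)) ^ i.k)
    {M₂ : ℝ} (hM₂ : 0 ≤ M₂) (hrepr : ∀ (v : Matrix (Fin N) (Fin N) ℂ) (j : ι), |b.repr v j| ≤ M₂ * ‖v‖)
    (d' : ℕ) {r A : ℝ} (hA : 0 ≤ A) (hr : 0 ≤ r)
    (htri : Triangle254 (toB6 (geo9K i) Rr Hp)) (hrefl : ∀ y : (geo9K i).Site, (geo9K i).dist y y = 0)
    (hdnn : ∀ y y' : (geo9K i).Site, 0 ≤ (geo9K i).dist y y')
    (h261 : Ineq261 d' (toB6 (geo9K i) Rr Hp) r (1 / 2)) (h263 : Ineq263 d' (toB6 (geo9K i) Rr Hp) r (1 / 2))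
    (hsmall : α₀' * (32 * ((d : ℝ) + 1) ^ 2 * (M₂ * ∑ j, ‖b j‖) * A * B6.c1 d' r (1 / 2)) ≤ 1 / 2)
    (hGs : HasMajorant (g := toB6 (geo9K i) Rr Hp) (fun p : SiteY i × ι => ιB (blkOf i.D.toDomains p.1))
      (conj b ((etaS i ^ 2) • (GpY i (parSymY i) U).restrictScalars ℝ)) (fun a a' => A * (geo9K i).len a ^ 2 * Real.exp (-(r * (geo9K i).dist a a')))) :
    HasMajorant (g := toB6 (geo9K i) Rr Hp) (fun p : SiteY i × ι => ιB (blkOf i.D.toDomains p.1))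
      (conj b ((etaS i ^ 2) • (GpY i (parKnitY i) U).restrictScalars ℝ))
      (fun a a' => 2 * A * B6.c1 d' r (1 / 2) * (geo9K i).len a ^ 2 * Real.exp (-((1 - 1 / 2) * r * (geo9K i).dist a a'))) := by
  set θ : ℝ := (etaS i ^ 2)⁻¹ * (32 * ((d : ℝ) + 1) ^ 2 * α₀' * (((((ℓ + 1) ^ i.k : ℕ) : ℝ)) ^ 2)⁻¹) * (M₂ * ∑ j, ‖b j‖) * A * 1 with hθdef
  have hθ : θ * B6.c1 d' r (1 / 2) = α₀' * (32 * ((d : ℝ) + 1) ^ 2 * (M₂ * ∑ j, ‖b j‖) * A * B6.c1 d' r (1 / 2)) := by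
    rw [hθdef, eps_print_units]; ring
  have hθc : θ * B6.c1 d' r (1 / 2) ≤ 1 / 2 := hθ ▸ hsmall
  have h := hasMajorant_conj_GpY_parKnitY_of_parSymY i b ιB (Rr := Rr) (Hp := Hp) hG hGa hU hα hα3 hα2 h52 hM₂ hrepr d' (δ₀ := r) (α := 1 / 2)
    (P := fun a => (geo9K i).len a ^ 2) (Pmax := 1) hA (fun y => sq_nonneg _) (geo9K_len_sq_le_one i hcf) (by linarith) htri hrefl hdnn h261 h263
    (B9Ineq349SiteComposite.etaS_pos i).ne' (by linarith) hGs
  refine hasMajorant_mono _ h fun a a' => ?_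
  have hc : 0 ≤ B6.c1 d' r (1 / 2) := c1_nonneg _ _ _
  have hinv : (1 - θ * B6.c1 d' r (1 / 2))⁻¹ ≤ 2 := inv_one_sub_le_two hθc
  have hpre : A * B6.c1 d' r (1 / 2) * (1 - θ * B6.c1 d' r (1 / 2))⁻¹ ≤ 2 * A * B6.c1 d' r (1 / 2) := by
    calc A * B6.c1 d' r (1 / 2) * (1 - θ * B6.c1 d' r (1 / 2))⁻¹ ≤ A * B6.c1 d' r (1 / 2) * 2 :=
          mul_le_mul_of_nonneg_left hinv (mul_nonneg hA hc)
      _ = 2 * A * B6.c1 d' r (1 / 2) := by ring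
  exact mul_le_mul_of_nonneg_right (mul_le_mul_of_nonneg_right hpre (sq_nonneg _)) (Real.exp_nonneg _)

end Print

/-! ## §3 ★★★ Theorem 3.2 (3.48) for `C(U)` at the knit letter, at a `U(N)`-valued (3.35)-regular background of the class (52), from the cube data, modulo Theorem D -/

section Main

variable {N : ℕ} {G : Subgroup (Matrix (Fin N) (Fin N) ℂ)ˣ}
variable {ι : Type} [Fintype ι] [DecidableEq ι] (b : Module.Basis ι ℝ (Matrix (Fin N) (Fin N) ℂ))

/-- ★★★ **THEOREM 3.2 (3.48) FOR `C(U) = (Q′G′²Q′*)⁻¹(U)` AT PRINT's KNIT LETTER, AT A `U(N)`-VALUED (3.35)-REGULAR BACKGROUND OF THE CLASS (52), FOR EVERY MEMBER ABOVE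
ONE THRESHOLD, FROM THE PER-CUBE (3.35) DATA, MODULO THEOREM D** (FILE 10 + FILE 9 + junction files 9, 23a–23c; located smallness discharged by `a₀`, geometry by
`geo_ladder`): for `G ≤ U(N)` averaging-closed, `N ≥ 1`, the walk data `(Rr, Hp)`, a real basis `b` of `M_N(ℂ)` with coordinate bound `M₂` and Theorem D's constants
`κ_D ≥ 0`, `δ_D > 0`, there are `δ > 0`, `K ≥ 0`, thresholds `M₀, T₀, N₀`, `a₁ > 0` and `a₀ > 0` such that for every `0 < α₀′ ≤ a₀` with `C₀α₀′ ≤ ⅓`, `2α₀′ ≤ c₂′`,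
every member above the thresholds with `c_f = L^k`, every section `ιB`, every `G`-valued `U` with `pdev (liftCfg U) < α₀′(L^k)⁻²`, every family of per-cube (3.35)
data (as in FILE 10) and every background family through `U`: IF Theorem D's localized-difference majorants hold at every rate `0 ≤ a ≤ δ_D` (FILE 10's `hDf`), THEN
`conj b((η²η²)⁻¹•(Q′G′²Q′*)⁻¹(U; parKnitY)) ≺ K·(ℓ(a)⁴)⁻¹·e^{−δ·d(a,a′)}` on the block carrier `(s, j) ↦ ιB s`.
DESIGN CONSTANTS (not printed constants): `K = 2K_Tc₁(r∕2⁷, ½)` and `δ = r∕2⁸` with `r = min(δ_G, δ_T)` (FILE 9's and FILE 10's rates; the halvings replace print's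
«arbitrarily close»); the size `a₀ = min(1∕(2(Φ₁+1)), 1∕(2(Φ_R+1)))` of the located-smallness discharge (`small_of_le`: `α₀′Φ ≤ ½`, whence `θc₁ ≤ ½` in junction file 9
and `θ_Rc₁ ≤ ½` in file 23c, `(1 − ·)⁻¹ ≤ 2`) depends on `d`, `L = ℓ+1`, `M₂Σ_j‖b_j‖`, FILE 9's `K_G, δ_G`, FILE 10's `K_T, δ_T` and the member family's (2.61) constants
`c₁` at the ladder rates `r, r∕4, r∕16, r∕64, r∕128` (`Φ₁ = 32(d+1)²(M₂Σ‖b‖)²K_Gc₁(r,½)`, `Φ_R` = file 23b's `θ_F∕α₀′` times `K_TL⁴c₁c₁`) — on nothing else (not on the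
member, on `U`, or on `α₀′`).
[cite: Balaban1985BackgroundPropagators, Thm 3.2 (3.48) p.398 + (3.19) p.393 + Thm 3.1 (3.42) p.397 + Thm 3.9 p.413 + (3.95)–(3.97) pp.411–412 + Thm 3.7 pp.409–410 + Cor. 3.6 p.408 + Thm 3.11 p.416; Balaban1984PropagatorsII, (2.50)–(2.52) p.232 + Lemma 2.1 (2.60)–(2.67) p.234 + (2.83)–(2.85) p.237; Balaban1985Averaging, (52)–(53) pp.26–27] -/
theorem cinv_at_knit_member_of_cubeData_unitary [Nonempty (Fin N)] [∀ i' : KIdx d ℓ hd hL b₀ b₁, Fintype (geo9K i').Site]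
    [∀ i' : KIdx d ℓ hd hL b₀ b₁, DecidableEq (geo9K i').Site] (hG : G ≤ unitaryUnits (Matrix (Fin N) (Fin N) ℂ)) (hGa : AvgClosed (d + 1) (ℓ + 1) G)
    (Rr : KIdx d ℓ hd hL b₀ b₁ → ℝ) (Hp : KIdx d ℓ hd hL b₀ b₁ → Prop)
    (hℓ : 1 ≤ ℓ) {M₂ : ℝ} (hM₂ : 0 ≤ M₂) (hrepr : ∀ (v : Matrix (Fin N) (Fin N) ℂ) (j : ι), |b.repr v j| ≤ M₂ * ‖v‖)
    {κD δD : ℝ} (hκD : 0 ≤ κD) (hδD : 0 < δD) :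
    ∃ δ K M₀ T₀ : ℝ, ∃ N₀ : ℕ, 0 < δ ∧ 0 ≤ K ∧ ∃ a₁ : ℝ, 0 < a₁ ∧ ∃ a₀ : ℝ, 0 < a₀ ∧
    ∀ (α₀' : ℝ), 0 < α₀' → α₀' ≤ a₀ → C0 (d + 1) * α₀' ≤ 1 / 3 → 2 * α₀' ≤ c2' (d + 1) (ℓ + 1) →
    ∀ (i : KIdx d ℓ hd hL b₀ b₁),
      M₀ ≤ ((ℓ : ℝ) + 1) * (toKT i).Mh → N₀ + 1 ≤ (toKT i).R * ((ℓ + 1) * (toKT i).Mh) → T₀ ≤ RM1 i → i.cf = (((ℓ + 1 : ℕ) : ℝ)) ^ i.k →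
    ∀ (ιB : BlkY i → IBondY i), (∀ s, β i.hN i.D i.hk (ιB s) = s) →
    ∀ (U : CfgY (Matrix (Fin N) (Fin N) ℂ) i), (∀ μ x, U μ x ∈ G) → pdev (liftCfg U) < α₀' * ((((ℓ + 1 : ℕ) : ℝ) ^ i.k)⁻¹) ^ 2 →
    ∀ (g : ↥(cubes (toKT i).D.toDomains) → GaugeY (Matrix (Fin N) (Fin N) ℂ) i),
      (∀ c x, ‖(g c x : Matrix (Fin N) (Fin N) ℂ)‖ ≤ 1 ∧ ‖(((g c x)⁻¹ : (Matrix (Fin N) (Fin N) ℂ)ˣ) : Matrix (Fin N) (Fin N) ℂ)‖ ≤ 1) →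
    ∀ (A : ↥(cubes (toKT i).D.toDomains) → AfldY (Matrix (Fin N) (Fin N) ℂ) i)
      (Q : ↥(cubes (toKT i).D.toDomains) → Set (Site (PV d ℓ i.m i.K hd hL) 0)) (C ξ Λ : ↥(cubes (toKT i).D.toDomains) → ℝ),
      (∀ c, 0 ≤ C c) → (∀ c, 0 < ξ c) → (∀ c, 1 ≤ Λ c) → (∀ c, ξ c ≤ 5 * (SC i c : ℝ) * (kGeo i).eta) →
      (∀ c, LatticeNorms.scaleLen ((ℓ : ℝ) + 1) (kGeo i).eta (c.1.1 + 1) ≤ Λ c * ξ c) →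
      (∀ c, ∀ x : Site (PV d ℓ i.m i.K hd hL) 0, NearC i c (35 * SC i c / 8 + 1) (boxEquiv i.hN x).1 → x ∈ Q c) →
      (∀ c, ∀ (κ : Fin (d + 1)) (x : Site (PV d ℓ i.m i.K hd hL) 0), x ∈ Q c → x.shift κ ∈ Q c →
        gaugeY i (g c) U κ x = fluct (kGeo i).eta (A c) κ x) →
      (∀ c, ∀ κ, ∀ x ∈ Q c, ‖A c κ x‖ ≤ C c * (ξ c)⁻¹) →
      (∀ c, ∀ μ ν, ∀ x ∈ Q c,
        ‖(((kGeo i).eta : ℂ)⁻¹) • covD (shiftsV1 (PV d ℓ i.m i.K hd hL)) (fun _ _ => (1 : (Matrix (Fin N) (Fin N) ℂ)ˣ)) μ (A c ν) x‖ ≤ C c * (ξ c ^ 2)⁻¹) →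
      (∀ c, max (C c) (C c * (1 + D1 thetaProf)) * Λ c ^ 2 ≤ a₁) → (∀ c, max (C c) (C c * (1 + D1 thetaProf)) * Λ c ^ 2 ≤ 1 / 4) →
    ∀ {B : B9.Backgrounds} (cfg : B.Cfg → CfgY (Matrix (Fin N) (Fin N) ℂ) i) (U₁ : B.Cfg), cfg U₁ = U →
      (∀ a : ℝ, 0 ≤ a → a ≤ δD → ∀ c : ↥(cubes (toKT i).D.toDomains),
        HasMajorant (g := toB6 (geo9K i) (Rr i) (Hp i)) (fun p : BlkY i × ι => ιB p.1)
          (conj b ((etaS i ^ 2 * etaS i ^ 2) • ((cutMulY (𝔸 := Matrix (Fin N) (Fin N) ℂ) (chiBigT i c)).restrictScalars ℝ *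
            ((XY i (parSymY i) (GpY i (parSymY i)) U).restrictScalars ℝ -
              (XY i (parSymY i) (fun _ => locLetterY i c (parSymY i) (g c) (chiY i c) (locCfgY i c (kGeo i).eta (A c))) U).restrictScalars ℝ) *
            (cutMulY (𝔸 := Matrix (Fin N) (Fin N) ℂ) (cubeIndT i.D (one_le_Mh i) (four_le_P' i) c)).restrictScalars ℝ)))
          (fun a₀ a'' => κD * Real.exp (-(2 * δD * DsepT i)) * (geo9K i).len a₀ ^ 4 * Real.exp (-(a * (geo9K i).dist a₀ a'')))) →
      HasMajorant (g := toB6 (geo9K i) (Rr i) (Hp i)) (fun p : BlkY i × ι => ιB p.1)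
        (conj b ((etaS i ^ 2 * etaS i ^ 2)⁻¹ • (XinvY i (parKnitY i) (GpY i (parKnitY i)) U).restrictScalars ℝ))
        (fun a a' => K * ((geo9K i).len a ^ 4)⁻¹ * Real.exp (-(δ * (geo9K i).dist a a'))) := by
  -- FILE 9 (the `G′` block at def-Y's letter) and FILE 10 ((3.48) at def-Y's letter)
  obtain ⟨δG, KG, M₉, T₉, N₉, hδG, hKG, a₉, ha₉, H9⟩ := eBlock_GpY_of_cubeData_unitary b hG Rr Hp hℓ hM₂ hrepr
  obtain ⟨δT, KT, M₁₀, T₁₀, N₁₀, hδT, hKT, a₁₀, ha₁₀, H10⟩ := cinv_at_member_of_cubeData_unitary b hG Rr Hp hℓ hM₂ hrepr hκD hδD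
  -- the base rate `r = min(δ_G, δ_T)` and the geometry at the ladder
  obtain ⟨r, hrdef⟩ : ∃ r : ℝ, r = min δG δT := ⟨_, rfl⟩
  have hr : 0 < r := by rw [hrdef]; exact lt_min hδG hδT
  have hrG : r ≤ δG := by rw [hrdef]; exact min_le_left _ _
  have hrT : r ≤ δT := by rw [hrdef]; exact min_le_right _ _
  -- the numeric side conditions of the ladder (all from `r > 0`)
  have hH1G : (1 - 1 / 2) * r ≤ δG := by linarith
  have hH1T : (1 - 1 / 2) * r ≤ δT := by linarith
  have n1 : (0 : ℝ) ≤ 1 / 2 * ((1 - 1 / 2) * r) := by linarith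
  have n2 : (0 : ℝ) ≤ 1 / 2 := by norm_num
  have n3 : (1 / 2 : ℝ) ≤ 1 := by norm_num
  have n4 : (0 : ℝ) ≤ (1 - 1 / 2) * ((1 - 1 / 2) * r) := by linarith
  have n5 : (0 : ℝ) ≤ 1 / 2 * ((1 - 1 / 2) * ((1 - 1 / 2) * ((1 - 1 / 2) * r))) := by linarith
  have n6 : (0 : ℝ) ≤ (1 - 1 / 2) * ((1 - 1 / 2) * ((1 - 1 / 2) * ((1 - 1 / 2) * r))) := by linarith
  have n7 : (0 : ℝ) ≤ 1 / 2 * ((1 - 1 / 2) * ((1 - 1 / 2) * ((1 - 1 / 2) * ((1 - 1 / 2) * ((1 - 1 / 2) * r))))) := by linarith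
  have n8 : (0 : ℝ) ≤ (1 - 1 / 2) * ((1 - 1 / 2) * ((1 - 1 / 2) * ((1 - 1 / 2) * ((1 - 1 / 2) * ((1 - 1 / 2) * r))))) := by linarith
  have n9 : (0 : ℝ) ≤ (1 - 1 / 2) * ((1 - 1 / 2) * ((1 - 1 / 2) * ((1 - 1 / 2) * ((1 - 1 / 2) * ((1 - 1 / 2) * ((1 - 1 / 2) * ((1 - 1 / 2) * r))))))) := by linarith
  have n10 : (0 : ℝ) < (1 - 1 / 2) * ((1 - 1 / 2) * ((1 - 1 / 2) * ((1 - 1 / 2) * ((1 - 1 / 2) * ((1 - 1 / 2) * ((1 - 1 / 2) * ((1 - 1 / 2) * r))))))) := by linarith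
  have hL2 : (0 : ℝ) ≤ (((ℓ : ℝ) + 1) ^ 2) := by positivity
  have hL4 : (0 : ℝ) ≤ (((ℓ : ℝ) + 1) ^ 4) := by positivity
  obtain ⟨ML, d₁, d₂, d₃, d₄, d₅, Hgeo⟩ := geo_ladder (d := d) (ℓ := ℓ) (hd := hd) (hL := hL) (b₀ := b₀) (b₁ := b₁) Rr Hp hr
  -- the constants: `A_s = M₂Σ‖b‖·K_G`, the two smallness coefficients `Φ₁` (junction file 9) and `Φ_R` (file 23c), the size `a₀`
  obtain ⟨As, hAsdef⟩ : ∃ As : ℝ, As = M₂ * (∑ j, ‖b j‖) * KG := ⟨_, rfl⟩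
  have hSb : 0 ≤ ∑ j, ‖b j‖ := Finset.sum_nonneg fun _ _ => norm_nonneg _
  have hAs : 0 ≤ As := by rw [hAsdef]; exact mul_nonneg (mul_nonneg hM₂ hSb) hKG
  have hc₅ : 0 ≤ B6.c1 d₅ r (1 / 2) := c1_nonneg _ _ _
  have hc1a : 0 ≤ B6.c1 d₁ ((1 - 1 / 2) * ((1 - 1 / 2) * r)) (1 / 2) := c1_nonneg _ _ _
  have hc1b : 0 ≤ B6.c1 d₂ ((1 - 1 / 2) * ((1 - 1 / 2) * ((1 - 1 / 2) * ((1 - 1 / 2) * r)))) (1 / 2) := c1_nonneg _ _ _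
  have hc1c : 0 ≤ B6.c1 d₃ ((1 - 1 / 2) * ((1 - 1 / 2) * ((1 - 1 / 2) * ((1 - 1 / 2) * ((1 - 1 / 2) * ((1 - 1 / 2) * r)))))) (1 / 2) := c1_nonneg _ _ _
  have hc1d : 0 ≤ B6.c1 d₄ ((1 - 1 / 2) * ((1 - 1 / 2) * ((1 - 1 / 2) * ((1 - 1 / 2) * ((1 - 1 / 2) * ((1 - 1 / 2) * ((1 - 1 / 2) * r))))))) (1 / 2) := c1_nonneg _ _ _
  obtain ⟨Φ₁, hΦ₁def⟩ : ∃ Φ₁ : ℝ, Φ₁ = 32 * ((d : ℝ) + 1) ^ 2 * (M₂ * ∑ j, ‖b j‖) * As * B6.c1 d₅ r (1 / 2) := ⟨_, rfl⟩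
  have hΦ₁ : 0 ≤ Φ₁ := by rw [hΦ₁def]; positivity
  obtain ⟨ΦR, hΦRdef⟩ : ∃ ΦR : ℝ, ΦR = ((2 * (8 * ((d : ℝ) + 1) ^ 2 * 1) * (M₂ * ∑ j, ‖b j‖)) * (M₂ * ∑ j, ‖b j‖) * (As * As * (((ℓ : ℝ) + 1) ^ 2) * B6.c1 d₁ ((1 - 1 / 2) * ((1 - 1 / 2) * r)) (1 / 2)) +
          (M₂ * ∑ j, ‖b j‖) * (M₂ * ∑ j, ‖b j‖) *
            ((As + (2 * As * B6.c1 d₅ r (1 / 2))) * ((2 * As * B6.c1 d₅ r (1 / 2)) * ((32 * ((d : ℝ) + 1) ^ 2 * 1 * (M₂ * ∑ j, ‖b j‖)) * As) * (((ℓ : ℝ) + 1) ^ 2) * B6.c1 d₁ ((1 - 1 / 2) * ((1 - 1 / 2) * r)) (1 / 2)) * (((ℓ : ℝ) + 1) ^ 2) * B6.c1 d₂ ((1 - 1 / 2) * ((1 - 1 / 2) * ((1 - 1 / 2) * ((1 - 1 / 2) * r)))) (1 / 2)) +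
          (M₂ * ∑ j, ‖b j‖) * ((2 * (8 * ((d : ℝ) + 1) ^ 2 * 1) * (M₂ * ∑ j, ‖b j‖))) * ((2 * As * B6.c1 d₅ r (1 / 2)) * (2 * As * B6.c1 d₅ r (1 / 2)) * (((ℓ : ℝ) + 1) ^ 2) * B6.c1 d₁ ((1 - 1 / 2) * ((1 - 1 / 2) * r)) (1 / 2))) * KT * (((ℓ : ℝ) + 1) ^ 4) *
        B6.c1 d₃ ((1 - 1 / 2) * ((1 - 1 / 2) * ((1 - 1 / 2) * ((1 - 1 / 2) * ((1 - 1 / 2) * ((1 - 1 / 2) * r)))))) (1 / 2) *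
        B6.c1 d₄ ((1 - 1 / 2) * ((1 - 1 / 2) * ((1 - 1 / 2) * ((1 - 1 / 2) * ((1 - 1 / 2) * ((1 - 1 / 2) * ((1 - 1 / 2) * r))))))) (1 / 2) := ⟨_, rfl⟩
  have hΦR : 0 ≤ ΦR := by rw [hΦRdef]; positivity
  obtain ⟨a₀, ha₀def⟩ : ∃ a₀ : ℝ, a₀ = min (1 / (2 * (Φ₁ + 1))) (1 / (2 * (ΦR + 1))) := ⟨_, rfl⟩
  have ha₀ : 0 < a₀ := by rw [ha₀def]; exact lt_min (by positivity) (by positivity)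
  have hAk : 0 ≤ (2 * As * B6.c1 d₅ r (1 / 2)) := by positivity
  have hK' : 0 ≤ 2 * KT * B6.c1 d₄ ((1 - 1 / 2) * ((1 - 1 / 2) * ((1 - 1 / 2) * ((1 - 1 / 2) * ((1 - 1 / 2) * ((1 - 1 / 2) * ((1 - 1 / 2) * r))))))) (1 / 2) := by positivity
  refine ⟨(1 - 1 / 2) * ((1 - 1 / 2) * ((1 - 1 / 2) * ((1 - 1 / 2) * ((1 - 1 / 2) * ((1 - 1 / 2) * ((1 - 1 / 2) * ((1 - 1 / 2) * r))))))), 2 * KT * B6.c1 d₄ ((1 - 1 / 2) * ((1 - 1 / 2) * ((1 - 1 / 2) * ((1 - 1 / 2) * ((1 - 1 / 2) * ((1 - 1 / 2) * ((1 - 1 / 2) * r))))))) (1 / 2), max (max M₉ M₁₀) ML, max T₉ T₁₀, max N₉ N₁₀, n10, hK', min a₉ a₁₀, lt_min ha₉ ha₁₀, a₀, ha₀, ?_⟩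
  intro α₀' hα ha₀' hα3 hα2
  have hθE : 0 ≤ 32 * ((d : ℝ) + 1) ^ 2 * α₀' * (M₂ * ∑ j, ‖b j‖) := by positivity
  -- the two located smallnesses from `α₀′ ≤ a₀`
  have hs₁ : α₀' * Φ₁ ≤ 1 / 2 := small_of_le hΦ₁ (ha₀'.trans (by rw [ha₀def]; exact min_le_left _ _))
  rw [hΦ₁def] at hs₁
  have hs₂ : α₀' * ΦR ≤ 1 / 2 := small_of_le hΦR (ha₀'.trans (by rw [ha₀def]; exact min_le_right _ _))
  have hlin : ((2 * (8 * ((d : ℝ) + 1) ^ 2 * α₀') * (M₂ * ∑ j, ‖b j‖)) * (M₂ * ∑ j, ‖b j‖) * (As * As * (((ℓ : ℝ) + 1) ^ 2) * B6.c1 d₁ ((1 - 1 / 2) * ((1 - 1 / 2) * r)) (1 / 2)) +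
          (M₂ * ∑ j, ‖b j‖) * (M₂ * ∑ j, ‖b j‖) *
            ((As + (2 * As * B6.c1 d₅ r (1 / 2))) * ((2 * As * B6.c1 d₅ r (1 / 2)) * ((32 * ((d : ℝ) + 1) ^ 2 * α₀' * (M₂ * ∑ j, ‖b j‖)) * As) * (((ℓ : ℝ) + 1) ^ 2) * B6.c1 d₁ ((1 - 1 / 2) * ((1 - 1 / 2) * r)) (1 / 2)) * (((ℓ : ℝ) + 1) ^ 2) * B6.c1 d₂ ((1 - 1 / 2) * ((1 - 1 / 2) * ((1 - 1 / 2) * ((1 - 1 / 2) * r)))) (1 / 2)) +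
          (M₂ * ∑ j, ‖b j‖) * ((2 * (8 * ((d : ℝ) + 1) ^ 2 * α₀') * (M₂ * ∑ j, ‖b j‖))) * ((2 * As * B6.c1 d₅ r (1 / 2)) * (2 * As * B6.c1 d₅ r (1 / 2)) * (((ℓ : ℝ) + 1) ^ 2) * B6.c1 d₁ ((1 - 1 / 2) * ((1 - 1 / 2) * r)) (1 / 2))) * KT * (((ℓ : ℝ) + 1) ^ 4) *
        B6.c1 d₃ ((1 - 1 / 2) * ((1 - 1 / 2) * ((1 - 1 / 2) * ((1 - 1 / 2) * ((1 - 1 / 2) * ((1 - 1 / 2) * r)))))) (1 / 2) *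
        B6.c1 d₄ ((1 - 1 / 2) * ((1 - 1 / 2) * ((1 - 1 / 2) * ((1 - 1 / 2) * ((1 - 1 / 2) * ((1 - 1 / 2) * ((1 - 1 / 2) * r))))))) (1 / 2) = α₀' * ΦR := by
    rw [hΦRdef]; ring
  have hsmall : ((2 * (8 * ((d : ℝ) + 1) ^ 2 * α₀') * (M₂ * ∑ j, ‖b j‖)) * (M₂ * ∑ j, ‖b j‖) * (As * As * (((ℓ : ℝ) + 1) ^ 2) * B6.c1 d₁ ((1 - 1 / 2) * ((1 - 1 / 2) * r)) (1 / 2)) +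
          (M₂ * ∑ j, ‖b j‖) * (M₂ * ∑ j, ‖b j‖) *
            ((As + (2 * As * B6.c1 d₅ r (1 / 2))) * ((2 * As * B6.c1 d₅ r (1 / 2)) * ((32 * ((d : ℝ) + 1) ^ 2 * α₀' * (M₂ * ∑ j, ‖b j‖)) * As) * (((ℓ : ℝ) + 1) ^ 2) * B6.c1 d₁ ((1 - 1 / 2) * ((1 - 1 / 2) * r)) (1 / 2)) * (((ℓ : ℝ) + 1) ^ 2) * B6.c1 d₂ ((1 - 1 / 2) * ((1 - 1 / 2) * ((1 - 1 / 2) * ((1 - 1 / 2) * r)))) (1 / 2)) +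
          (M₂ * ∑ j, ‖b j‖) * ((2 * (8 * ((d : ℝ) + 1) ^ 2 * α₀') * (M₂ * ∑ j, ‖b j‖))) * ((2 * As * B6.c1 d₅ r (1 / 2)) * (2 * As * B6.c1 d₅ r (1 / 2)) * (((ℓ : ℝ) + 1) ^ 2) * B6.c1 d₁ ((1 - 1 / 2) * ((1 - 1 / 2) * r)) (1 / 2))) * KT * (((ℓ : ℝ) + 1) ^ 4) *
        B6.c1 d₃ ((1 - 1 / 2) * ((1 - 1 / 2) * ((1 - 1 / 2) * ((1 - 1 / 2) * ((1 - 1 / 2) * ((1 - 1 / 2) * r)))))) (1 / 2) *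
        B6.c1 d₄ ((1 - 1 / 2) * ((1 - 1 / 2) * ((1 - 1 / 2) * ((1 - 1 / 2) * ((1 - 1 / 2) * ((1 - 1 / 2) * ((1 - 1 / 2) * r))))))) (1 / 2) < 1 := by
    rw [hlin]; exact lt_of_le_of_lt hs₂ (by norm_num)
  have hinv : (1 - ((2 * (8 * ((d : ℝ) + 1) ^ 2 * α₀') * (M₂ * ∑ j, ‖b j‖)) * (M₂ * ∑ j, ‖b j‖) * (As * As * (((ℓ : ℝ) + 1) ^ 2) * B6.c1 d₁ ((1 - 1 / 2) * ((1 - 1 / 2) * r)) (1 / 2)) +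
          (M₂ * ∑ j, ‖b j‖) * (M₂ * ∑ j, ‖b j‖) *
            ((As + (2 * As * B6.c1 d₅ r (1 / 2))) * ((2 * As * B6.c1 d₅ r (1 / 2)) * ((32 * ((d : ℝ) + 1) ^ 2 * α₀' * (M₂ * ∑ j, ‖b j‖)) * As) * (((ℓ : ℝ) + 1) ^ 2) * B6.c1 d₁ ((1 - 1 / 2) * ((1 - 1 / 2) * r)) (1 / 2)) * (((ℓ : ℝ) + 1) ^ 2) * B6.c1 d₂ ((1 - 1 / 2) * ((1 - 1 / 2) * ((1 - 1 / 2) * ((1 - 1 / 2) * r)))) (1 / 2)) +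
          (M₂ * ∑ j, ‖b j‖) * ((2 * (8 * ((d : ℝ) + 1) ^ 2 * α₀') * (M₂ * ∑ j, ‖b j‖))) * ((2 * As * B6.c1 d₅ r (1 / 2)) * (2 * As * B6.c1 d₅ r (1 / 2)) * (((ℓ : ℝ) + 1) ^ 2) * B6.c1 d₁ ((1 - 1 / 2) * ((1 - 1 / 2) * r)) (1 / 2))) * KT * (((ℓ : ℝ) + 1) ^ 4) *
        B6.c1 d₃ ((1 - 1 / 2) * ((1 - 1 / 2) * ((1 - 1 / 2) * ((1 - 1 / 2) * ((1 - 1 / 2) * ((1 - 1 / 2) * r)))))) (1 / 2) *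
        B6.c1 d₄ ((1 - 1 / 2) * ((1 - 1 / 2) * ((1 - 1 / 2) * ((1 - 1 / 2) * ((1 - 1 / 2) * ((1 - 1 / 2) * ((1 - 1 / 2) * r))))))) (1 / 2))⁻¹ ≤ 2 := by
    rw [hlin]; exact inv_one_sub_le_two hs₂
  have hpre : KT * B6.c1 d₄ ((1 - 1 / 2) * ((1 - 1 / 2) * ((1 - 1 / 2) * ((1 - 1 / 2) * ((1 - 1 / 2) * ((1 - 1 / 2) * ((1 - 1 / 2) * r))))))) (1 / 2) * (1 - ((2 * (8 * ((d : ℝ) + 1) ^ 2 * α₀') * (M₂ * ∑ j, ‖b j‖)) * (M₂ * ∑ j, ‖b j‖) * (As * As * (((ℓ : ℝ) + 1) ^ 2) * B6.c1 d₁ ((1 - 1 / 2) * ((1 - 1 / 2) * r)) (1 / 2)) +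
          (M₂ * ∑ j, ‖b j‖) * (M₂ * ∑ j, ‖b j‖) *
            ((As + (2 * As * B6.c1 d₅ r (1 / 2))) * ((2 * As * B6.c1 d₅ r (1 / 2)) * ((32 * ((d : ℝ) + 1) ^ 2 * α₀' * (M₂ * ∑ j, ‖b j‖)) * As) * (((ℓ : ℝ) + 1) ^ 2) * B6.c1 d₁ ((1 - 1 / 2) * ((1 - 1 / 2) * r)) (1 / 2)) * (((ℓ : ℝ) + 1) ^ 2) * B6.c1 d₂ ((1 - 1 / 2) * ((1 - 1 / 2) * ((1 - 1 / 2) * ((1 - 1 / 2) * r)))) (1 / 2)) +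
          (M₂ * ∑ j, ‖b j‖) * ((2 * (8 * ((d : ℝ) + 1) ^ 2 * α₀') * (M₂ * ∑ j, ‖b j‖))) * ((2 * As * B6.c1 d₅ r (1 / 2)) * (2 * As * B6.c1 d₅ r (1 / 2)) * (((ℓ : ℝ) + 1) ^ 2) * B6.c1 d₁ ((1 - 1 / 2) * ((1 - 1 / 2) * r)) (1 / 2))) * KT * (((ℓ : ℝ) + 1) ^ 4) *
        B6.c1 d₃ ((1 - 1 / 2) * ((1 - 1 / 2) * ((1 - 1 / 2) * ((1 - 1 / 2) * ((1 - 1 / 2) * ((1 - 1 / 2) * r)))))) (1 / 2) *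
        B6.c1 d₄ ((1 - 1 / 2) * ((1 - 1 / 2) * ((1 - 1 / 2) * ((1 - 1 / 2) * ((1 - 1 / 2) * ((1 - 1 / 2) * ((1 - 1 / 2) * r))))))) (1 / 2))⁻¹ ≤ 2 * KT * B6.c1 d₄ ((1 - 1 / 2) * ((1 - 1 / 2) * ((1 - 1 / 2) * ((1 - 1 / 2) * ((1 - 1 / 2) * ((1 - 1 / 2) * ((1 - 1 / 2) * r))))))) (1 / 2) := by
    calc KT * B6.c1 d₄ ((1 - 1 / 2) * ((1 - 1 / 2) * ((1 - 1 / 2) * ((1 - 1 / 2) * ((1 - 1 / 2) * ((1 - 1 / 2) * ((1 - 1 / 2) * r))))))) (1 / 2) * (1 - ((2 * (8 * ((d : ℝ) + 1) ^ 2 * α₀') * (M₂ * ∑ j, ‖b j‖)) * (M₂ * ∑ j, ‖b j‖) * (As * As * (((ℓ : ℝ) + 1) ^ 2) * B6.c1 d₁ ((1 - 1 / 2) * ((1 - 1 / 2) * r)) (1 / 2)) +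
          (M₂ * ∑ j, ‖b j‖) * (M₂ * ∑ j, ‖b j‖) *
            ((As + (2 * As * B6.c1 d₅ r (1 / 2))) * ((2 * As * B6.c1 d₅ r (1 / 2)) * ((32 * ((d : ℝ) + 1) ^ 2 * α₀' * (M₂ * ∑ j, ‖b j‖)) * As) * (((ℓ : ℝ) + 1) ^ 2) * B6.c1 d₁ ((1 - 1 / 2) * ((1 - 1 / 2) * r)) (1 / 2)) * (((ℓ : ℝ) + 1) ^ 2) * B6.c1 d₂ ((1 - 1 / 2) * ((1 - 1 / 2) * ((1 - 1 / 2) * ((1 - 1 / 2) * r)))) (1 / 2)) +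
          (M₂ * ∑ j, ‖b j‖) * ((2 * (8 * ((d : ℝ) + 1) ^ 2 * α₀') * (M₂ * ∑ j, ‖b j‖))) * ((2 * As * B6.c1 d₅ r (1 / 2)) * (2 * As * B6.c1 d₅ r (1 / 2)) * (((ℓ : ℝ) + 1) ^ 2) * B6.c1 d₁ ((1 - 1 / 2) * ((1 - 1 / 2) * r)) (1 / 2))) * KT * (((ℓ : ℝ) + 1) ^ 4) *
        B6.c1 d₃ ((1 - 1 / 2) * ((1 - 1 / 2) * ((1 - 1 / 2) * ((1 - 1 / 2) * ((1 - 1 / 2) * ((1 - 1 / 2) * r)))))) (1 / 2) *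
        B6.c1 d₄ ((1 - 1 / 2) * ((1 - 1 / 2) * ((1 - 1 / 2) * ((1 - 1 / 2) * ((1 - 1 / 2) * ((1 - 1 / 2) * ((1 - 1 / 2) * r))))))) (1 / 2))⁻¹
        ≤ KT * B6.c1 d₄ ((1 - 1 / 2) * ((1 - 1 / 2) * ((1 - 1 / 2) * ((1 - 1 / 2) * ((1 - 1 / 2) * ((1 - 1 / 2) * ((1 - 1 / 2) * r))))))) (1 / 2) * 2 := mul_le_mul_of_nonneg_left hinv (mul_nonneg hKT hc1d)
      _ = 2 * KT * B6.c1 d₄ ((1 - 1 / 2) * ((1 - 1 / 2) * ((1 - 1 / 2) * ((1 - 1 / 2) * ((1 - 1 / 2) * ((1 - 1 / 2) * ((1 - 1 / 2) * r))))))) (1 / 2) := by ring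
  intro i hM hN hT hcf ιB hι U hU h52 g hu A Q C ξ Λ hC0 hξ hΛ hξS hΛξ hQ hgA hA hdA hα₁ hα4 B cfg U₁ hcfg hDf
  -- the thresholds of the three suppliers
  have hM₉ : M₉ ≤ ((ℓ : ℝ) + 1) * (toKT i).Mh := ((le_max_left _ _).trans (le_max_left _ _)).trans hM
  have hM₁₀ : M₁₀ ≤ ((ℓ : ℝ) + 1) * (toKT i).Mh := ((le_max_right _ _).trans (le_max_left _ _)).trans hM
  have hML : ML ≤ (geo9K i).M := by
    rw [geo9K_M_eq' i]; exact (le_max_right _ _).trans hM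
  have hN₉ : N₉ + 1 ≤ (toKT i).R * ((ℓ + 1) * (toKT i).Mh) := (Nat.add_le_add_right (le_max_left _ _) 1).trans hN
  have hN₁₀ : N₁₀ + 1 ≤ (toKT i).R * ((ℓ + 1) * (toKT i).Mh) := (Nat.add_le_add_right (le_max_right _ _) 1).trans hN
  have hT₉ : T₉ ≤ RM1 i := (le_max_left _ _).trans hT
  have hT₁₀ : T₁₀ ≤ RM1 i := (le_max_right _ _).trans hT
  have hα₁G : ∀ c, max (C c) (C c * (1 + D1 thetaProf)) * Λ c ^ 2 ≤ a₉ := fun c => (hα₁ c).trans (min_le_left _ _)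
  have hα₁T : ∀ c, max (C c) (C c * (1 + D1 thetaProf)) * Λ c ^ 2 ≤ a₁₀ := fun c => (hα₁ c).trans (min_le_right _ _)
  -- FILE 9: the (3.42) block of `G′(U; parSymY)`; FILE 10: (3.48) at def-Y's letter
  obtain ⟨hEG, -⟩ := H9 i hM₉ hN₉ hT₉ hcf ιB hι U hU g hu A Q C ξ Λ hC0 hξ hΛ hξS hΛξ hQ hgA hA hdA hα₁G hα4 cfg U₁ hcfg
  have hT₀ := H10 i hM₁₀ hN₁₀ hT₁₀ hcf ιB hι U hU g hu A Q C ξ Λ hC0 hξ hΛ hξS hΛξ hQ hgA hA hdA hα₁T hα4 cfg U₁ hcfg hDf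
  -- the geometry at the ladder
  obtain ⟨⟨htri, hrefl, hdnn⟩, h261a, h261b, ⟨h261J, h263J⟩, h261c, h261d, h263d, hSTa, hSTb, hSTc⟩ := Hgeo i hML
  subst hcfg
  -- `η²G′_sym`: the (3.42)₁ READ of FILE 9's block (D1), at the rates `r` and `r∕2`
  have hGs := hasMajorant_conj_G_of_eBlockInv i b cfg (GpY i (parSymY i)) (parSymY i) (Rr := Rr i) (Hp := Hp i) hEG hKG ιB hι hM₂ hrepr rfl
    ((etaS i ^ 2) • (GpY i (parSymY i) (cfg U₁)).restrictScalars ℝ) (fun _ => rfl)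
  rw [← hAsdef] at hGs
  have hl2 : ∀ a : (geo9K i).Site, 0 ≤ (geo9K i).len a ^ 2 := fun a => sq_nonneg _
  have hGs_r := hasMajorant_rate_mono i (Rr := Rr i) (Hp := Hp i) (fun p : SiteY i × ι => ιB (blkOf i.D.toDomains p.1))
    (fun a => (geo9K i).len a ^ 2) hAs hl2 hrG hGs
  have hGs_c := hasMajorant_rate_mono i (Rr := Rr i) (Hp := Hp i) (fun p : SiteY i × ι => ιB (blkOf i.D.toDomains p.1))
    (fun a => (geo9K i).len a ^ 2) hAs hl2 hH1G hGs
  -- `η²G′_knit`: junction file 9 in print's units (smallness `α₀′Φ₁ ≤ ½`)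
  have hGk := hasMajorant_conj_GpY_parKnitY_print b i ιB (Rr := Rr i) (Hp := Hp i) hG hGa hU hα hα3 hα2 h52 hcf hM₂ hrepr d₅ hAs hr.le htri hrefl hdnn
    h261J h263J hs₁ hGs_r
  -- the diagonal of `η⁻²(Δ′_sym − Δ′_knit)` in print's units; FILE 10's `T₀` at the rate `r∕2`
  have hE := hasMajorant_conj_smul_sub_print b i ιB (Rr := Rr i) (Hp := Hp i) hG hGa hU hα hα3 hα2 h52 hM₂ hrepr
  have hw4 : ∀ a : (geo9K i).Site, 0 ≤ ((geo9K i).len a ^ 4)⁻¹ := fun a => inv_nonneg.2 (pow_nonneg (geo9K_len_pos i a).le 4)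
  have hT₀_c := hasMajorant_rate_mono i (Rr := Rr i) (Hp := Hp i) (fun q : BlkY i × ι => ιB q.1) (fun a => ((geo9K i).len a ^ 4)⁻¹) hKT hw4
    hH1T hT₀
  -- junction file 23c §4 at the ladder
  have h4 := hasMajorant_conj_XinvY_parKnitY_of_letters i b ιB (Rr := Rr i) (Hp := Hp i) hG hGa hU hα hα3 hα2 h52 hcf hM₂ hrepr d₁ d₂ d₃ d₄
    (δ := (1 - 1 / 2) * r) (αst := 1 / 2) (α' := 1 / 2) (α := 1 / 2) (C := (((ℓ : ℝ) + 1) ^ 2)) (C₄ := (((ℓ : ℝ) + 1) ^ 4)) (As := As) (Ak := (2 * As * B6.c1 d₅ r (1 / 2)))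
    (θE := 32 * ((d : ℝ) + 1) ^ 2 * α₀' * (M₂ * ∑ j, ‖b j‖)) (K := KT) hAs hAk hθE hKT hL2 hL4
    n1 n2 n3 n4 n5 n6 n7 n8 n9 htri hrefl hdnn hSTa h261a hSTb h261b hSTc h261c h261d h263d hsmall hE hGs_c hGk hT₀_c
  -- the constant: `(1 − α₀′Φ_R)⁻¹ ≤ 2`
  exact hasMajorant_mono _ h4 fun a a' => mul_le_mul_of_nonneg_right (mul_le_mul_of_nonneg_right hpre (hw4 a)) (Real.exp_nonneg _)

end Main

end Literature.MathematicalPhysics.QuantumFieldTheory.Balaban1983to89.B9Thm32CinvAtKnitLetterOfCubeData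

end
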